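import Summits.QuantumFields.YangMills.Theorems.FibreToTorus.Negative.RateLoadBearing
import Summits.QuantumFields.YangMills.Theorems.LatticeGapOnTrajectory.Negative.ZeroCoupling

/-!
# `FibreToTorus` — support lemma: the free-tube family holds IN KIND at zero coupling, for every rate
# (non-vacuity of the shape of the hypothesis; the quantifier placement `∃ m ∀ w ∃ C ∀ M ∃ Lmin` is consistent)

Support file for crux `stmt-QuantumFields-16244`
(`Summit.QuantumFields.YangMills.Theses.ContractibleFibre.FibreToTorus`, route `ContractibleFibre`, rank 4),
extracted from the standing disprover's work file `Cruxes/FibreToTorus/Disproof.lean` §5 (cycle 1).  Bodies inline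
(no auxiliary `def … : Prop`); tree objects only (`cov_ratio_le_two` of `Negative/RateLoadBearing.lean`, the
product-measure factorisation `LatticeGapOnTrajectory.Negative.integral_mul_eq_of_dependsOn_disjoint`).

* `tube_coupling_zero` — for every compact `G`, faithful `r`, width `M`, rate `m ≥ 0` and slab width `w`, the route
  file's predicate `Tube M 0 m (2 e^{mw}) w 0` holds: at `β = 0` the tube weight is `1`, the measure is the product
  of Haar probability measures; for `n ≤ w` the a-priori bound `2 ≤ 2e^{mw}e^{-mn}`; for `w < n` (`2n < L`) the
  slab `{p | (p.1.1 − c).val ≤ w}` and the support `{q | (q.1.1 − n − c).val ≤ w}` of `F₂ ∘ σ_n` are disjoint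
  (`ZMod.val` arithmetic: `(b + n).val = b.val + n` as `b.val + n ≤ w + n < 2n < L`), so the covariance vanishes.
* `tubeFamily_prefix_at_coupling_zero` — hence the prefix `∀ m > 0 ∀ w ∃ C ∀ M ∃ Lmin, Tube M 0 m C w Lmin` is met by
  every `(G, r)`: the hypothesis of `FibreToTorus` is satisfiable in kind at one coupling with `M`-uniform
  constants and idle volume floor; what is open (`FibreContinuity`) is the same display at all LARGE `β`.  With
  `Negative/RateLoadBearing.lean` (rate) and `Negative/SeparationBoundLoadBearing.lean` (`2n < L`) this completes
  the shape audit of the hypothesis; the proof is also a worked instance of the `Loc`/`σ_n`/slab bookkeeping that the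
  thermodynamic-limit stub (T) of lines `birth`/`uniqueness` must perform.

Nothing here asserts a statement of the route (negative/support lane, `--supports stmt-QuantumFields-16244`). [folklore]
-/

noncomputable section

namespace Summit.QuantumFields.YangMills.Theorems.FibreToTorus.Negative

open MeasureTheory Filter Topology
open Literature.MathematicalPhysics.QuantumFieldTheory

/-- **At zero coupling the free-tube family holds in kind, for every rate.**  For every compact `G`, faithful `r`,
width `M`, rate `m ≥ 0` and slab width `w`: `TubeClusters G r M 0 m (2 e^{mw}) w 0`.  At `β = 0` the weight is `1`
and the tube measure is the product of Haar probability measures, so (i) for `n ≤ w` the a-priori bound `2`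
(`cov_ratio_le_two`) is below `2e^{mw}e^{-mn}`, and (ii) for `w < n` (and `2n < L`) the slab `[c, c+w]` and its
shift by `n` are DISJOINT sets of links mod `L`, on which `F₁` and `F₂ ∘ σ_n` respectively depend, so the
covariance vanishes exactly (tree `LatticeGapOnTrajectory.Negative.integral_mul_eq_of_dependsOn_disjoint`,
Mathlib `iIndepFun_pi`).  This certifies the quantifier placement of the hypothesis (`C` after `w`, before `M`
and `L`; `Lmin` idle) and exercises the inline vocabulary (`Loc`, `σ`, `ZMod.val` slab arithmetic) once in Lean —
the bookkeeping stub (T) of lines `birth`/`uniqueness` needs verbatim. [folklore] -/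
theorem tube_coupling_zero (G : Type) [Group G] [TopologicalSpace G] [IsTopologicalGroup G] [CompactSpace G]
    [MeasurableSpace G] [BorelSpace G] (r : LatticeRep G) (M : ℕ) {m : ℝ} (hm : 0 ≤ m) (w : ℕ) :
    let Tube := fun (M : ℕ) (β m C : ℝ) (w Lmin : ℕ) => ∀ (L : ℕ) [NeZero L], Lmin ≤ L → let St := ZMod L × ZMod L × Fin (M + 1) × Fin (M + 1); let Cfg := St × Fin 4 → G; let ν : MeasureTheory.Measure Cfg := MeasureTheory.Measure.pi fun _ => haarProbability G; let sh : St → Fin 4 → St := fun x μ => ![(x.1 + 1, x.2.1, x.2.2.1, x.2.2.2), (x.1, x.2.1 + 1, x.2.2.1, x.2.2.2), (x.1, x.2.1, x.2.2.1 + 1, x.2.2.2), (x.1, x.2.1, x.2.2.1, x.2.2.2 + 1)] μ; let ins : St → Fin 4 → Fin 4 → ℝ := fun x μ κ => if ((μ = 2 ∨ κ = 2) → (x.2.2.1 : ℕ) < M) ∧ ((μ = 3 ∨ κ = 3) → (x.2.2.2 : ℕ) < M) then 1 else 0; let pl : Cfg → St → Fin 4 → Fin 4 → G := fun U x μ κ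 => U (x, μ) * U (sh x μ, κ) * (U (sh x κ, μ))⁻¹ * (U (x, κ))⁻¹; let act : Cfg → ℝ := fun U => β * ∑ x : St, ∑ q : {q : Fin 4 × Fin 4 // q.1 < q.2}, ins x q.1.1 q.1.2 * (r.ρ (pl U x q.1.1 q.1.2)).trace.re; let wgt : Cfg → ℝ := fun U => Real.exp (act U); let Ex : (Cfg → ℝ) → ℝ := fun F => (∫ U, F U * wgt U ∂ν) / (∫ U, wgt U ∂ν); let σ : ℕ → Cfg → Cfg := fun n U p => U ((p.1.1 + n, p.1.2), p.2); ∀ c : ZMod L, let Loc := fun F : Cfg → ℝ => Measurable F ∧ (∀ U, |F U| ≤ 1) ∧ ∀ U U', (∀ p : St × Fin 4, (p.1.1 - c).val ≤ w → U p = U' p) → F U = F U'; ∀ F₁ F₂ : Cfg → ℝ, Loc F₁ → Loc F₂ → ∀ n : ℕ, 2 * n < L → |Ex (fun U => F₁ U * F₂ (σ n U)) - Ex F₁ * Ex (fun U => F₂ (σ n U))| ≤ C * Real.exp (-(m * n)); Tube M 0 m (2 * Real.exp (m * w)) w 0 := by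
  classical
  haveI : SecondCountableTopology G :=
    (r.continuous.isClosedEmbedding r.injective).isEmbedding.secondCountableTopology
  have hρ : Continuous fun g : G => ((r.ρ g).trace).re :=
    Complex.continuous_re.comp r.continuous.matrix_trace
  intro Tube L _ _
  dsimp only [Tube]
  intro c F₁ F₂ hF₁ hF₂ n hn
  by_cases hnw : n ≤ w
  · -- overlapping slabs: the a-priori bound `2 ≤ 2 e^{mw} e^{-mn}`
    refine (cov_ratio_le_two (MeasureTheory.Measure.pi fun _ => haarProbability G) ?_ hF₁.2.1
      (fun U => hF₂.2.1 _)).trans ?_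
    · refine continuous_const.mul (continuous_finsetSum _ fun x _ =>
        continuous_finsetSum _ fun q _ => continuous_const.mul (hρ.comp ?_))
      fun_prop
    · rw [mul_assoc, ← Real.exp_add]
      have hnw' : (n : ℝ) ≤ w := by exact_mod_cast hnw
      have h0 : 0 ≤ m * (w : ℝ) + -(m * n) := by nlinarith
      nlinarith [Real.add_one_le_exp (m * (w : ℝ) + -(m * n))]
  · -- disjoint slabs: at `β = 0` the weight is `1`, and the covariance factorises exactly
    push Not at hnw
    simp only [zero_mul, Real.exp_zero, mul_one, integral_const, smul_eq_mul, probReal_univ, div_one]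
    -- the two index sets
    set I : Finset ((ZMod L × ZMod L × Fin (M + 1) × Fin (M + 1)) × Fin 4) :=
      Finset.univ.filter fun p => (p.1.1 - c).val ≤ w with hI
    set J : Finset ((ZMod L × ZMod L × Fin (M + 1) × Fin (M + 1)) × Fin 4) :=
      Finset.univ.filter fun p => (p.1.1 - (n : ZMod L) - c).val ≤ w with hJ
    have hIJ : Disjoint I J := by
      rw [hI, hJ, Finset.disjoint_filter]
      intro q _ h1 h2
      have hnL : n < L := by omega
      have hval : ((n : ZMod L)).val = n := ZMod.val_natCast_of_lt hnL
      have heq : q.1.1 - c = (q.1.1 - (n : ZMod L) - c) + (n : ZMod L) := by ring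
      have hadd := ZMod.val_add (q.1.1 - (n : ZMod L) - c) (n : ZMod L)
      rw [← heq, hval] at hadd
      have hlt : (q.1.1 - (n : ZMod L) - c).val + n < L := by omega
      rw [Nat.mod_eq_of_lt hlt] at hadd
      omega
    have hdep₁ : DependsOn F₁ (↑I : Set ((ZMod L × ZMod L × Fin (M + 1) × Fin (M + 1)) × Fin 4)) := by
      intro U U' h
      exact hF₁.2.2 U U' fun p hp => h p (by rw [hI]; simpa using hp)
    have hdep₂ : DependsOn (fun U : (ZMod L × ZMod L × Fin (M + 1) × Fin (M + 1)) × Fin 4 → G =>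
        F₂ (fun p => U ((p.1.1 + (n : ZMod L), p.1.2), p.2)))
        (↑J : Set ((ZMod L × ZMod L × Fin (M + 1) × Fin (M + 1)) × Fin 4)) := by
      intro U U' h
      refine hF₂.2.2 _ _ fun p hp => h ((p.1.1 + (n : ZMod L), p.1.2), p.2) ?_
      rw [hJ]
      simpa [add_sub_cancel_right] using hp
    have hσm : Measurable fun (U : (ZMod L × ZMod L × Fin (M + 1) × Fin (M + 1)) × Fin 4 → G) =>
        fun p : (ZMod L × ZMod L × Fin (M + 1) × Fin (M + 1)) × Fin 4 => U ((p.1.1 + (n : ZMod L), p.1.2), p.2) :=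
      measurable_pi_lambda _ fun p => measurable_pi_apply _
    have hfac := Summit.QuantumFields.YangMills.Theorems.LatticeGapOnTrajectory.Negative.integral_mul_eq_of_dependsOn_disjoint
      (haarProbability G) I J hIJ hdep₁ hdep₂ hF₁.1 (hF₂.1.comp hσm)
    rw [hfac, sub_self, abs_zero]
    positivity


/-- **The hypothesis prefix of `FibreToTorus` is met at zero coupling by every `(G, r)`, for every rate.** [folklore] -/
theorem tubeFamily_prefix_at_coupling_zero (G : Type) [Group G] [TopologicalSpace G] [IsTopologicalGroup G]
    [CompactSpace G] [MeasurableSpace G] [BorelSpace G] (r : LatticeRep G) {m : ℝ} (hm : 0 < m) :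
    let Tube := fun (M : ℕ) (β m C : ℝ) (w Lmin : ℕ) => ∀ (L : ℕ) [NeZero L], Lmin ≤ L → let St := ZMod L × ZMod L × Fin (M + 1) × Fin (M + 1); let Cfg := St × Fin 4 → G; let ν : MeasureTheory.Measure Cfg := MeasureTheory.Measure.pi fun _ => haarProbability G; let sh : St → Fin 4 → St := fun x μ => ![(x.1 + 1, x.2.1, x.2.2.1, x.2.2.2), (x.1, x.2.1 + 1, x.2.2.1, x.2.2.2), (x.1, x.2.1, x.2.2.1 + 1, x.2.2.2), (x.1, x.2.1, x.2.2.1, x.2.2.2 + 1)] μ; let ins : St → Fin 4 → Fin 4 → ℝ := fun x μ κ => if ((μ = 2 ∨ κ = 2) → (x.2.2.1 : ℕ) < M) ∧ ((μ = 3 ∨ κ = 3) → (x.2.2.2 : ℕ) < M) then 1 else 0; let pl : Cfg → St → Fin 4 → Fin 4 → G := fun U x μ κ => U (x, μ) * U (sh x μ, κ) * (U (sh x κ, μ))⁻¹ * (U (x, κ))⁻¹; let act : Cfg → ℝ := fun U => β * ∑ x : St, ∑ q : {q : Fin 4 × Fin 4 // q.1 < q.2}, ins x q.1.1 q.1.2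 * (r.ρ (pl U x q.1.1 q.1.2)).trace.re; let wgt : Cfg → ℝ := fun U => Real.exp (act U); let Ex : (Cfg → ℝ) → ℝ := fun F => (∫ U, F U * wgt U ∂ν) / (∫ U, wgt U ∂ν); let σ : ℕ → Cfg → Cfg := fun n U p => U ((p.1.1 + n, p.1.2), p.2); ∀ c : ZMod L, let Loc := fun F : Cfg → ℝ => Measurable F ∧ (∀ U, |F U| ≤ 1) ∧ ∀ U U', (∀ p : St × Fin 4, (p.1.1 - c).val ≤ w → U p = U' p) → F U = F U'; ∀ F₁ F₂ : Cfg → ℝ, Loc F₁ → Loc F₂ → ∀ n : ℕ, 2 * n < L → |Ex (fun U => F₁ U * F₂ (σ n U)) - Ex F₁ * Ex (fun U => F₂ (σ n U))| ≤ C * Real.exp (-(m * n)); ∀ w : ℕ, ∃ C : ℝ, ∀ M : ℕ, ∃ Lmin : ℕ, Tube M 0 m C w Lmin := by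
  intro Tube w
  exact ⟨2 * Real.exp (m * w), fun M => ⟨0, tube_coupling_zero G r M hm.le w⟩⟩

/-- Sanity (kernel-checked): the `Tube` written above IS the crux's, i.e. `FibreToTorus` is by `Iff.rfl` the display
below over the same vocabulary. -/
example : Summit.QuantumFields.YangMills.Theses.ContractibleFibre.FibreToTorus ↔
    (∀ (G : Type) [Group G] [TopologicalSpace G] [IsTopologicalGroup G] [CompactSpace G], IsCompactSimpleLieGroup G → letI : MeasurableSpace G := borel G; haveI : BorelSpace G := ⟨rfl⟩; ∀ r : LatticeRep G, let Tube := fun (M : ℕ) (β m C : ℝ) (w Lmin : ℕ) => ∀ (L : ℕ) [NeZero L], Lmin ≤ L → let St := ZMod L × ZMod L × Fin (M + 1) × Fin (M + 1); let Cfg := St × Fin 4 → G; let ν : MeasureTheory.Measure Cfg := MeasureTheory.Measure.pi fun _ => haarProbability G; let sh : St → Fin 4 → St := fun x μ => ![(x.1 + 1, x.2.1, x.2.2.1, x.2.2.2), (x.1, x.2.1 + 1, x.2.2.1, x.2.2.2), (x.1, x.2.1, x.2.2.1 + 1, x.2.2.2), (x.1, x.2.1, x.2.2.1, x.2.2.2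 + 1)] μ; let ins : St → Fin 4 → Fin 4 → ℝ := fun x μ κ => if ((μ = 2 ∨ κ = 2) → (x.2.2.1 : ℕ) < M) ∧ ((μ = 3 ∨ κ = 3) → (x.2.2.2 : ℕ) < M) then 1 else 0; let pl : Cfg → St → Fin 4 → Fin 4 → G := fun U x μ κ => U (x, μ) * U (sh x μ, κ) * (U (sh x κ, μ))⁻¹ * (U (x, κ))⁻¹; let act : Cfg → ℝ := fun U => β * ∑ x : St, ∑ q : {q : Fin 4 × Fin 4 // q.1 < q.2}, ins x q.1.1 q.1.2 * (r.ρ (pl U x q.1.1 q.1.2)).trace.re; let wgt : Cfg → ℝ := fun U => Real.exp (act U); let Ex : (Cfg → ℝ) → ℝ := fun F => (∫ U, F U * wgt U ∂ν) / (∫ U, wgt U ∂ν); let σ : ℕ → Cfg → Cfg := fun n U p => U ((p.1.1 + n, p.1.2), p.2); ∀ c : ZMod L, let Loc := fun F : Cfg → ℝ => Measurable F ∧ (∀ U, |F U| ≤ 1) ∧ ∀ U U', (∀ p : St × Fin 4, (p.1.1 - c).val ≤ w → U p = U' p) → F U = F U'; ∀ F₁ F₂ : Cfg → ℝ, Loc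 F₁ → Loc F₂ → ∀ n : ℕ, 2 * n < L → |Ex (fun U => F₁ U * F₂ (σ n U)) - Ex F₁ * Ex (fun U => F₂ (σ n U))| ≤ C * Real.exp (-(m * n)); (∃ β₁ : ℝ, ∀ β : ℝ, β₁ ≤ β → ∃ m : ℝ, 0 < m ∧ ∀ w : ℕ, ∃ C : ℝ, ∀ M : ℕ, ∃ Lmin : ℕ, Tube M β m C w Lmin) → ∃ β₀ : ℝ, ∀ β : ℝ, β₀ ≤ β → ∃ m : ℝ, 0 < m ∧ ∃ S₁ : ℕ, ∀ A B : YMSpecies G, ∃ C : ℝ, ∀ S n : ℕ, S₁ ≤ S → n ≤ S → |latticeConnectedCorr r.ρ β (2 * S + 1) A.F B.F n| ≤ C * Real.exp (-(m * n))) :=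
  Iff.rfl

end Summit.QuantumFields.YangMills.Theorems.FibreToTorus.Negative

end
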